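import Summits.Ventures.CertifiedArithmetic.Expansions.WeakExpansionStep

/-!
# Weakly nonoverlapping expansions, part 4 (§7): Theorem 1

HONEST FRAMING (ENGINES group, unit `eng-quad-4`, kernels lane of the `certquad` engine — shared
numerical engines serving client cells; rigour lives in the verifiers; every published number
belongs to a client cell's ledger, not to the engines group): NEW WORK of the lane's Lean line, not a
published result, hence under `Summits/Ventures/` with no citation tag; nothing here is cited anywhere
as a literature fact.  Overview, statements in words, evidence and the proof outline (§1–§11):
module docstring of `WeakExpansion.lean` in this directory.  This file introduces no definitions.

CONTENTS.  `FesInvW.advance` (a loop step in either orientation), `FesInvW.isExpansion_growExpansion`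
and THEOREM 1 `fastExpansionSum_nonoverlapping_of_isWeakExpansion`: for any round-to-nearest rounding
and `p ≥ 4`, FAST-EXPANSION-SUM of two weakly nonoverlapping expansions is a nonoverlapping expansion
(increasing except for zeros) of `m + n` floats with the exact sum; and its pairwise form
`fastExpansionSum_pairwise_nonoverlapping_of_isWeakExpansion`.
-/

namespace Summit.Ventures.CertifiedArithmetic.Expansions

open Literature.ComputerArithmetic.JeannerodRump2018
open Literature.ComputerArithmetic.BoldoJeannerodMelquiondMuller2023 hiding twoSum twoSum_fst isFloat_twoSum
open Literature.ComputerArithmetic.Shewchuk1997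

variable {p : ℕ} {emin : ℤ} {fl : ℚ → ℚ}

/-! ### §7  Theorem 1: FAST-EXPANSION-SUM of weakly nonoverlapping expansions is nonoverlapping -/

/-- One iteration of the loop from an arbitrary state: the next merged component `z` is the head of
`e₂` or of `f₂` (merge order), and the step lemma applies directly or with the roles of `e` and `f`
exchanged. -/
theorem FesInvW.advance (hp : 4 ≤ p) (hfl : IsRoundNearest p emin fl)
    {e f : List ℚ} (heF : ∀ x ∈ e, IsFloat p emin x) (hes : IsWeakExpansion e)
    (hfF : ∀ x ∈ f, IsFloat p emin x) (hfs : IsWeakExpansion f)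
    {z : ℚ} {rs e₁ f₁ e₂ f₂ : List ℚ} {Q : ℚ} {hs : List ℚ} {g : ℤ}
    (hm : mergeExpansions e₂ f₂ = z :: rs) (hI : FesInvW p emin e f e₁ f₁ e₂ f₂ Q hs g) :
    ∃ (e₁' f₁' e₂' f₂' : List ℚ) (g' : ℤ), mergeExpansions e₂' f₂' = rs ∧
      FesInvW p emin e f e₁' f₁' e₂' f₂' (twoSum fl Q z).1 (hs ++ [(twoSum fl Q z).2]) g' ∧
      |(twoSum fl Q z).2| < (2 : ℚ) ^ g' ∧
      ((twoSum fl Q z).2 ≠ 0 → g' = Int.log 2 |(twoSum fl Q z).2| + 1) := by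
  rcases mergeExpansions_eq_cons hm with ⟨e₂', rfl, hrs, hhead⟩ | ⟨f₂', rfl, hrs, hhead⟩
  · -- `z` is the next component of `e`
    have hzle : ∀ x ∈ f₂, x ≠ 0 → |z| ≤ |x| := by
      intro x hx hx0
      cases f₂ with
      | nil => simp at hx
      | cons y ys =>
        have hzy := hhead y ys rfl
        rcases List.mem_cons.mp hx with rfl | hx
        · exact hzy
        · have hpw := hfs.1
          rw [hI.inv.hf, List.pairwise_append, List.pairwise_cons] at hpw
          exact le_trans hzy ((hpw.2.1.1 x hx).abs_lt hx0).le
    obtain ⟨g', hI', hlt, hg'⟩ := hI.step hp hfl heF hes hfF hfs hzle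
    exact ⟨_, _, _, _, g', hrs.symm, hI', hlt, hg'⟩
  · -- `z` is the next component of `f`: the same with the roles of `e` and `f` exchanged
    have hzle : ∀ x ∈ e₂, x ≠ 0 → |z| ≤ |x| := by
      intro x hx hx0
      cases e₂ with
      | nil => simp at hx
      | cons y ys =>
        have hzy := hhead y ys rfl
        rcases List.mem_cons.mp hx with rfl | hx
        · exact hzy.le
        · have hpw := hes.1
          rw [hI.inv.he, List.pairwise_append, List.pairwise_cons] at hpw
          exact le_trans hzy.le ((hpw.2.1.1 x hx).abs_lt hx0).le
    obtain ⟨g', hI', hlt, hg'⟩ := hI.swap.step hp hfl hfF hfs heF hes hzle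
    exact ⟨_, _, _, _, g', hrs.symm, hI'.swap, hlt, hg'⟩

/-- The loop from any state of the strengthened invariant yields a nonoverlapping increasing
expansion (the analogue of `FesInv.isExpansion_growExpansion`). -/
theorem FesInvW.isExpansion_growExpansion (hp : 4 ≤ p) (hfl : IsRoundNearest p emin fl)
    {e f : List ℚ} (heF : ∀ x ∈ e, IsFloat p emin x) (hes : IsWeakExpansion e)
    (hfF : ∀ x ∈ f, IsFloat p emin x) (hfs : IsWeakExpansion f) :
    ∀ (rs e₁ f₁ e₂ f₂ : List ℚ) (Q : ℚ) (hs : List ℚ) (g : ℤ), mergeExpansions e₂ f₂ = rs →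
      FesInvW p emin e f e₁ f₁ e₂ f₂ Q hs g → IsExpansion 1 (growExpansion fl rs Q) := by
  have hp1 : 1 ≤ p := le_trans (by norm_num) hp
  intro rs
  induction rs with
  | nil => intro e₁ f₁ e₂ f₂ Q hs g _ _; exact isExpansion_singleton 1 Q
  | cons z rs ih =>
    intro e₁ f₁ e₂ f₂ Q hs g hm hI
    rw [growExpansion_cons, isExpansion_cons]
    obtain ⟨e₁', f₁', e₂', f₂', g', hrs, hI', hlt, -⟩ := hI.advance hp hfl heF hes hfF hfs hm
    refine ⟨fun w hw => ?_, ih e₁' f₁' e₂' f₂' _ _ g' hrs hI'⟩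
    -- every later output lies on the grid `2^g'` (grid invariant of GROW-EXPANSION), above `|h|`
    have hrsF : ∀ x ∈ rs, IsFloat p emin x := fun x hx => by
      rw [← hrs, mem_mergeExpansions] at hx
      exact hx.elim (fun hx => heF x (by rw [hI'.inv.he]; exact List.mem_append_right _ hx))
        fun hx => hfF x (by rw [hI'.inv.hf]; exact List.mem_append_right _ hx)
    have hrsG : ∀ x ∈ rs, OnGrid g' x := fun x hx => by
      rw [← hrs, mem_mergeExpansions] at hx
      exact hI'.inv.hrg x (List.mem_append.mpr hx)
    exact ⟨g', onGrid_of_mem_growExpansion hp1 hfl hI'.inv.hg hI'.inv.hQ hrsF hI'.inv.hQg hrsG w hw,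
      by rw [one_mul]; exact hlt⟩

/-- **THEOREM 1 (repairs the induction of Shewchuk's Theorem 13).**  For ANY round-to-nearest
rounding and any precision `p ≥ 4`: if `e` and `f` are WEAKLY NONOVERLAPPING expansions of `p`-bit
floats (`IsWeakExpansion`: sorted by magnitude except for zeros, nonoverlapping, every component
adjacent to a larger one a power of two, no component adjacent to two others), then
`FAST-EXPANSION-SUM(e, f)` is a nonoverlapping expansion (increasing except for zeros) of
`m + n` floats whose sum is `e + f` exactly.  Since strongly nonoverlapping ⊂ weakly nonoverlapping
(`IsStrongExpansion.isWeakExpansion`) this contains the true part of Theorem 13; since the class is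
closed under the operation under round-half-even (Theorem 2 below), it is what makes
FAST-EXPANSION-SUM composable. -/
theorem fastExpansionSum_nonoverlapping_of_isWeakExpansion (hp : 4 ≤ p)
    (hfl : IsRoundNearest p emin fl) {e f : List ℚ}
    (heF : ∀ x ∈ e, IsFloat p emin x) (hes : IsWeakExpansion e)
    (hfF : ∀ x ∈ f, IsFloat p emin x) (hfs : IsWeakExpansion f) :
    IsExpansion 1 (fastExpansionSum fl e f) ∧ (fastExpansionSum fl e f).sum = e.sum + f.sum ∧
      (fastExpansionSum fl e f).length = e.length + f.length ∧
      ∀ x ∈ fastExpansionSum fl e f, IsFloat p emin x := by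
  have hp1 : 1 ≤ p := le_trans (by norm_num) hp
  have hgF : ∀ x ∈ mergeExpansions e f, IsFloat p emin x := fun x hx =>
    (mem_mergeExpansions.mp hx).elim (heF x) (hfF x)
  have hlen := length_mergeExpansions e f
  refine ⟨?_, sum_fastExpansionSum hp1 hfl heF hfF hes.pairwise_abs_le hfs.pairwise_abs_le, ?_, ?_⟩
  · have hmain := FesInvW.isExpansion_growExpansion hp hfl heF hes hfF hfs (mergeExpansions e f)
      [] [] e f 0 [] emin rfl (FesInvW.init heF hfF)
    rcases hm : mergeExpansions e f with _ | ⟨g₁, gs⟩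
    · simp only [fastExpansionSum, hm]; exact isExpansion_nil 1
    · rw [fastExpansionSum_eq_growExpansion hp1 hfl heF hfF hes.pairwise_abs_le
        hfs.pairwise_abs_le hm]
      rw [hm, growExpansion_cons, twoSum_zero_left hfl (hgF g₁ (hm ▸ List.mem_cons_self)),
        isExpansion_cons] at hmain
      exact hmain.2
  · rcases hm : mergeExpansions e f with _ | ⟨g₁, gs⟩
    · rw [hm] at hlen; simp only [fastExpansionSum, hm]; simpa using hlen
    · rw [fastExpansionSum_eq_growExpansion hp1 hfl heF hfF hes.pairwise_abs_le
        hfs.pairwise_abs_le hm, length_growExpansion, ← hlen, hm, List.length_cons]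
  · rcases hm : mergeExpansions e f with _ | ⟨g₁, gs⟩
    · simp [fastExpansionSum, hm]
    · rw [fastExpansionSum_eq_growExpansion hp1 hfl heF hfF hes.pairwise_abs_le
        hfs.pairwise_abs_le hm]
      exact isFloat_of_mem_growExpansion hfl (hgF g₁ (hm ▸ List.mem_cons_self))

/-- Theorem 1, the nonoverlapping property in the paper's own words (§2.1) between any two output
components. -/
theorem fastExpansionSum_pairwise_nonoverlapping_of_isWeakExpansion (hp : 4 ≤ p)
    (hfl : IsRoundNearest p emin fl) {e f : List ℚ}
    (heF : ∀ x ∈ e, IsFloat p emin x) (hes : IsWeakExpansion e)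
    (hfF : ∀ x ∈ f, IsFloat p emin x) (hfs : IsWeakExpansion f) :
    (fastExpansionSum fl e f).Pairwise Nonoverlapping :=
  (fastExpansionSum_nonoverlapping_of_isWeakExpansion hp hfl heF hes hfF hfs).1.imp
    fun hab => hab.nonoverlapping

end Summit.Ventures.CertifiedArithmetic.Expansions
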